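import Summits.QuantumFields.YangMills.Theorems.BalabanUVNodesN15TwoSpacingGluingCovariantAdjoint
import HarnessLib

/-!
# THE GLUING STEP AT TWO LATTICE SPACINGS, XII: the SECOND-ORDER left factor (entry 3 of (3.42), `ΔG`) of the dressed parametrix — `D₃∘G₀ = Σ_□ [M_{h_□}(D₃G_□)M_{h_□} + ([D₃, M_{h_□}]G_□)M_{h_□}]`
# EXACTLY for ANY operator `D₃`, so its letter and its η-defect need NO cube information beyond the entry-3 rows `D₃G_□` and the commutator rows `[D₃, M_{h_□}]G_□` the remainder already
# uses (dag-n15-c g11, FILE 54; N15 = NE2, s1 «background-layer OPERATOR ingredient»; generic — flat `Σ∇*∇ + W` and covariant `Δ_R + W` alike)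

Cell `pub-ymgap`, seat `pub-ymgap-dag-n15-c` (R134 (a); HUMAN RULING D-0062), generation 11.  `bears_on: R4∕N15 · K3⁷ SpineGivenEndpointR13SepCoPH (stmt-QuantumFields-20544)`.
Filed `--supports stmt-QuantumFields-20544 --as helper` — COUNT-NEUTRAL.  Theorems only (0 `def`, 0 `sorry`).  Imports BY NAME FILE 53 `…N15TwoSpacingGluingCovariantAdjoint`
(`hasMaj_idef_comp_mulOp_loc`; through it FILE 49 `hasMaj_comp_mulOp_loc`, FILE 48 `hasMaj_sandwich_loc`, `hasMaj_idef_sandwich_loc`, `ind_mul_ind_le`, FILE 45 `parametrix`, `commOp`,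
`hasMaj_sum_overlap`, `idef_fsum`); nothing in the tree is modified.

WHY.  FILE 50's letter bundle `GluedLetters` has the rows `D₃′∘G₀′ ≤ Ae^{−δd}` and `𝔇(D₃′∘G₀′, D₃∘G₀) ≤ me^{−δd}` for the second-order left factor of entry 3 (`ΔG` in [B9] (3.42)); FILE 48
supplied entries 1∕2 (first-order factors, two-term Leibniz rules) but not entry 3.  For a second-order `D₃` the Leibniz rule is `D₃∘M_h = M_h∘D₃ + [D₃, M_h]` with an OPERATOR-valued
bracket — which is exactly the object whose rows `[D₃, M_{h_□}]∘G_□` the remainder `R` is made of (FILE 45 `hasMaj_remainder`'s `hKc`; FILES 46∕51∕52 supply them for `Σ∇*∇ + W`, `Q*aQ`,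
`Δ_R + W`).  So: ★ `comp_parametrix_of_commOp` — the identity in the title (pure algebra); ★★ `hasMaj_comp_parametrix_of_commOp` — `D₃∘G₀ ≤ N_ov(β₃ + θ₀)e^{−δd}` from the entry-3 rows
`D₃∘G_□ ≤ 1_S1_Sβ₃e^{−δd}`, the commutator rows `≤ 1_S1_Sθ₀e^{−δd}`, `|h| ≤ 1` and the overlap `≤ N_ov`; ★★ `hasMaj_idef_comp_parametrix_of_commOp` — its η-defect `≤ N_ov(2β₃o + m₃ + θ₀o +
r)e^{−δd}` from the fine rows, the partition fit `o`, and the row defects `m₃`, `r` (the remainder's `hDK`).  With FILE 44 `hasMaj_idef_comp_glueInv` this is entry 3 of the glued `G =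
G₀(1 − R)⁻¹`; for `D₃ = Δ_a` itself FILE 45 `lap_comp_glued` gives `Δ_aG = 1` exactly.

HONEST FRAMING ∕ LIMITS.  Algebra + diagonal block-majorant bookkeeping ([B9] (3.42) p.397, p.399; [B6] (2.91)–(2.92) p.239, (2.133)–(2.136) p.247 = SHAPES ∕ MECHANISM; nothing
asserted); every cube row stays displayed.  NE2⁺ NOT PRINTED, NOT proved; N15 NOT discharged; counts of record UNMOVED (typed 28∕28 · discharged 5∕27); one finite 𝕋⁴ at fixed ε — NOT
infinite volume, NOT OS on ℝ⁴, NOT a mass gap, NOT Clay; R4 closes the conditional finite-𝕋⁴ rung `BalabanLadder.UV` only.  Restate-immune (no Theses import).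
-/

noncomputable section

namespace Summit.QuantumFields.YangMills.BalabanUVNodes.N15.Gluing

open Literature.MathematicalPhysics.QuantumFieldTheory.Balaban1983to89
open Literature.MathematicalPhysics.QuantumFieldTheory.Balaban1983to89.B11SectG (BlockNorm HasMaj)
open Literature.MathematicalPhysics.QuantumFieldTheory.Balaban1983to89.T4EtaRateDefect (idef idef_add)
open Literature.MathematicalPhysics.QuantumFieldTheory.Balaban1983to89.T4EtaRateCoeffDefect (pull)
open Literature.MathematicalPhysics.QuantumFieldTheory.Balaban1983to89.B6Prop26Gluing (mulOp ind ind_nonneg)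
open Summit.QuantumFields.YangMills.BalabanUVNodes.N15.BackgroundLayer (linearMap_comp_sum)

/-! ## §1 The second-order dressed parametrix -/

section Identity

variable {X : Type} {K : Type} [Fintype K]

/-- ★ **ENTRY 3 OF THE DRESSED PARAMETRIX, ANY `D₃`**: `D₃∘G₀ = Σ_□ [M_{h_□}∘(D₃∘G_□)∘M_{h_□} + ([D₃, M_{h_□}]∘G_□)∘M_{h_□}]` — from `D₃∘M_h = M_h∘D₃ + [D₃, M_h]`; only the entry-3 rows and the
remainder's commutator rows appear. [cite: Balaban1984PropagatorsII, (2.91)–(2.92) p.239, (2.136) p.247 (mechanism)] -/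
theorem comp_parametrix_of_commOp (D₃ : (X → ℝ) →ₗ[ℝ] (X → ℝ)) (h : K → X → ℝ) (G : K → (X → ℝ) →ₗ[ℝ] (X → ℝ)) :
    D₃ ∘ₗ parametrix h G = ∑ i, (mulOp (h i) ∘ₗ (D₃ ∘ₗ G i) ∘ₗ mulOp (h i) + (commOp D₃ (h i) ∘ₗ G i) ∘ₗ mulOp (h i)) := by
  rw [parametrix, linearMap_comp_sum]
  refine Finset.sum_congr rfl fun i _ => ?_
  have hleib : D₃ ∘ₗ mulOp (h i) = mulOp (h i) ∘ₗ D₃ + commOp D₃ (h i) := by rw [commOp]; abel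
  rw [← LinearMap.comp_assoc, hleib, LinearMap.add_comp]
  simp only [LinearMap.comp_assoc]

end Identity

/-! ## §2 Its letter from the entry-3 rows and the commutator rows -/

section Letter

variable {X : Type} [Fintype X] {K : Type} [Fintype K] {g : B6.Geometry} (blk : X → g.Site) (S : K → Set g.Site)

/-- ★★ **THE SECOND-ORDER DRESSED PARAMETRIX DECAYS**: entry-3 rows `D₃∘G_□ ≤ 1_S1_S·β₃e^{−δd}`, commutator rows `[D₃, M_{h_□}]∘G_□ ≤ 1_S1_S·θ₀e^{−δd}`, `|h_□| ≤ 1`, overlap `≤ N_ov` ⟹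
`D₃∘G₀ ≤ N_ov·(β₃ + θ₀)·e^{−δd}`. [cite: Balaban1984PropagatorsII, (2.133), (2.136) p.247 (shapes + mechanism); Balaban1985BackgroundPropagators, (3.42) p.397 (entry 3: shape)] -/
theorem hasMaj_comp_parametrix_of_commOp {D₃ : (X → ℝ) →ₗ[ℝ] (X → ℝ)} {h : K → X → ℝ} {G : K → (X → ℝ) →ₗ[ℝ] (X → ℝ)} {β₃ θ₀ δ Nov : ℝ} (hβ₃ : 0 ≤ β₃) (hθ : 0 ≤ θ₀)
    (hh : ∀ i x, |h i x| ≤ 1) (hN : ∀ a, ∑ i, ind (S i) a ≤ Nov)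
    (hG3 : ∀ i, HasMaj (BlockNorm.ofBlocks g blk) (BlockNorm.ofBlocks g blk) (D₃ ∘ₗ G i) (fun y y' => ind (S i) y * ind (S i) y' * (β₃ * Real.exp (-(δ * g.dist y y')))))
    (hKc : ∀ i, HasMaj (BlockNorm.ofBlocks g blk) (BlockNorm.ofBlocks g blk) (commOp D₃ (h i) ∘ₗ G i)
      (fun y y' => ind (S i) y * ind (S i) y' * (θ₀ * Real.exp (-(δ * g.dist y y'))))) :
    HasMaj (BlockNorm.ofBlocks g blk) (BlockNorm.ofBlocks g blk) (D₃ ∘ₗ parametrix h G) (fun y y' => Nov * (β₃ + θ₀) * Real.exp (-(δ * g.dist y y'))) := by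
  have hterm : ∀ i, HasMaj (BlockNorm.ofBlocks g blk) (BlockNorm.ofBlocks g blk) (mulOp (h i) ∘ₗ (D₃ ∘ₗ G i) ∘ₗ mulOp (h i) + (commOp D₃ (h i) ∘ₗ G i) ∘ₗ mulOp (h i))
      (fun y y' => ind (S i) y * ((β₃ + θ₀) * Real.exp (-(δ * g.dist y y')))) := fun i => by
    have t1 := hasMaj_sandwich_loc blk zero_le_one zero_le_one hβ₃ (hh i) (hh i) (hG3 i)
    have t2 := hasMaj_comp_mulOp_loc blk hθ zero_le_one (hh i) (hKc i)
    refine (t1.add t2).mono fun y y' => ?_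
    have key := ind_mul_ind_le (Sc := S i) (A := (β₃ + θ₀) * Real.exp (-(δ * g.dist y y'))) (mul_nonneg (by positivity) (Real.exp_nonneg _)) y y'
    calc ind (S i) y * ind (S i) y' * (1 * β₃ * 1 * Real.exp (-(δ * g.dist y y'))) + ind (S i) y * ind (S i) y' * (θ₀ * 1 * Real.exp (-(δ * g.dist y y')))
        = ind (S i) y * ind (S i) y' * ((β₃ + θ₀) * Real.exp (-(δ * g.dist y y'))) := by ring
      _ ≤ _ := key
  rw [comp_parametrix_of_commOp]
  refine (hasMaj_sum_overlap _ S _ Nov (fun y y' => mul_nonneg (by positivity) (Real.exp_nonneg _)) hterm hN).mono fun y y' => le_of_eq ?_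
  ring

end Letter

/-! ## §3 Its η-defect from the fine rows, the partition fit and the row defects -/

section Defect

variable {X X' : Type} [Fintype X] [Fintype X'] {K : Type} [Fintype K] {g : B6.Geometry} (blk : X → g.Site) (π : X' → X) (S : K → Set g.Site)

/-- ★★ **THE η-DEFECT OF THE SECOND-ORDER DRESSED PARAMETRIX**: coarse and fine entry-3 rows (`β₃`), fine commutator rows (`θ₀`), `|h|, |h′| ≤ 1`, the fit `|h′ − h∘π| ≤ o`, the row defects
`𝔇(D₃′G′_□, D₃G_□) ≤ 1_S1_S·m₃e^{−δd}`, `𝔇([D₃′, M_{h′_□}]G′_□, [D₃, M_{h_□}]G_□) ≤ 1_S1_S·re^{−δd}` (the remainder's `hDK`), overlap `≤ N_ov` ⟹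
`𝔇(D₃′∘G₀′, D₃∘G₀) ≤ N_ov·(2β₃o + m₃ + (θ₀o + r))·e^{−δd}`. [cite: Balaban1984PropagatorsII, (2.136) p.247 (shapes); Balaban1985BackgroundPropagators, Thm 3.14 pp.426–427 (difference template)] -/
theorem hasMaj_idef_comp_parametrix_of_commOp {D₃ : (X → ℝ) →ₗ[ℝ] (X → ℝ)} {D₃' : (X' → ℝ) →ₗ[ℝ] (X' → ℝ)} {h : K → X → ℝ} {h' : K → X' → ℝ}
    {G : K → (X → ℝ) →ₗ[ℝ] (X → ℝ)} {G' : K → (X' → ℝ) →ₗ[ℝ] (X' → ℝ)} {β₃ θ₀ o m₃ r δ Nov : ℝ} (hβ₃ : 0 ≤ β₃) (hθ : 0 ≤ θ₀) (ho : 0 ≤ o) (hm₃ : 0 ≤ m₃) (hr : 0 ≤ r)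
    (hh : ∀ i x, |h i x| ≤ 1) (hh' : ∀ i x', |h' i x'| ≤ 1) (hfit : ∀ i x', |h' i x' - h i (π x')| ≤ o) (hN : ∀ a, ∑ i, ind (S i) a ≤ Nov)
    (hG3 : ∀ i, HasMaj (BlockNorm.ofBlocks g blk) (BlockNorm.ofBlocks g blk) (D₃ ∘ₗ G i) (fun y y' => ind (S i) y * ind (S i) y' * (β₃ * Real.exp (-(δ * g.dist y y')))))
    (hG3' : ∀ i, HasMaj (BlockNorm.ofBlocks g (blk ∘ π)) (BlockNorm.ofBlocks g (blk ∘ π)) (D₃' ∘ₗ G' i)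
      (fun y y' => ind (S i) y * ind (S i) y' * (β₃ * Real.exp (-(δ * g.dist y y')))))
    (hKc' : ∀ i, HasMaj (BlockNorm.ofBlocks g (blk ∘ π)) (BlockNorm.ofBlocks g (blk ∘ π)) (commOp D₃' (h' i) ∘ₗ G' i)
      (fun y y' => ind (S i) y * ind (S i) y' * (θ₀ * Real.exp (-(δ * g.dist y y')))))
    (hDG3 : ∀ i, HasMaj (BlockNorm.ofBlocks g blk) (BlockNorm.ofBlocks g (blk ∘ π)) (idef (pull π) (pull π) (D₃' ∘ₗ G' i) (D₃ ∘ₗ G i))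
      (fun y y' => ind (S i) y * ind (S i) y' * (m₃ * Real.exp (-(δ * g.dist y y')))))
    (hDK : ∀ i, HasMaj (BlockNorm.ofBlocks g blk) (BlockNorm.ofBlocks g (blk ∘ π)) (idef (pull π) (pull π) (commOp D₃' (h' i) ∘ₗ G' i) (commOp D₃ (h i) ∘ₗ G i))
      (fun y y' => ind (S i) y * ind (S i) y' * (r * Real.exp (-(δ * g.dist y y'))))) :
    HasMaj (BlockNorm.ofBlocks g blk) (BlockNorm.ofBlocks g (blk ∘ π)) (idef (pull π) (pull π) (D₃' ∘ₗ parametrix h' G') (D₃ ∘ₗ parametrix h G))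
      (fun y y' => Nov * (2 * β₃ * o + m₃ + (θ₀ * o + r)) * Real.exp (-(δ * g.dist y y'))) := by
  have hterm : ∀ i, HasMaj (BlockNorm.ofBlocks g blk) (BlockNorm.ofBlocks g (blk ∘ π))
      (idef (pull π) (pull π) (mulOp (h' i) ∘ₗ (D₃' ∘ₗ G' i) ∘ₗ mulOp (h' i) + (commOp D₃' (h' i) ∘ₗ G' i) ∘ₗ mulOp (h' i))
        (mulOp (h i) ∘ₗ (D₃ ∘ₗ G i) ∘ₗ mulOp (h i) + (commOp D₃ (h i) ∘ₗ G i) ∘ₗ mulOp (h i)))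
      (fun y y' => ind (S i) y * ((2 * β₃ * o + m₃ + (θ₀ * o + r)) * Real.exp (-(δ * g.dist y y')))) := fun i => by
    have t1 := hasMaj_idef_sandwich_loc blk π zero_le_one zero_le_one ho ho hβ₃ hm₃ (hh' i) (hh i) (hfit i) (hfit i) (hG3 i) (hG3' i) (hDG3 i)
    have t2 := hasMaj_idef_comp_mulOp_loc blk π hθ hr zero_le_one ho (hh i) (hfit i) (hKc' i) (hDK i)
    rw [idef_add]
    refine (t1.add t2).mono fun y y' => ?_
    have key := ind_mul_ind_le (Sc := S i) (A := (2 * β₃ * o + m₃ + (θ₀ * o + r)) * Real.exp (-(δ * g.dist y y'))) (mul_nonneg (by positivity) (Real.exp_nonneg _)) y y'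
    calc ind (S i) y * ind (S i) y' * ((1 * β₃ * o + 1 * m₃ * 1 + o * β₃ * 1) * Real.exp (-(δ * g.dist y y'))) +
          ind (S i) y * ind (S i) y' * ((θ₀ * o + r * 1) * Real.exp (-(δ * g.dist y y')))
        = ind (S i) y * ind (S i) y' * ((2 * β₃ * o + m₃ + (θ₀ * o + r)) * Real.exp (-(δ * g.dist y y'))) := by ring
      _ ≤ _ := key
  rw [comp_parametrix_of_commOp, comp_parametrix_of_commOp, idef_fsum]
  refine (hasMaj_sum_overlap _ S _ Nov (fun y y' => mul_nonneg (by positivity) (Real.exp_nonneg _)) hterm hN).mono fun y y' => le_of_eq ?_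
  ring

end Defect

end Summit.QuantumFields.YangMills.BalabanUVNodes.N15.Gluing

end
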